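import Literature.IUT.LogVolume.DHProbabilisticSzpiro
import Literature.IUT.LogVolume.GenuineLogTheta
import HarnessLib

/-!
# Dupuy–Hilado's «Tautological Probabilistic Inequality» (DH-II Thm. 7.5.1, (7.3)) AT A GENUINE Θ-VOLUME INPUT
# is, verbatim, the number-level typed [IUTchIII] Cor. 3.12 in reading (U) (`ThetaVolumeInput.Cor312Of`)

PROOF-ONLY record file (no definition, no new `Prop`, nothing asserted about print) of the abc-iut cell,
D-0123(C) REPAIR-CATALOGUE, tester seat abc-iut-rcat-tst-1 (KERNEL-CLOSE column), catalogue row **RC-607**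
(= lit-abc-dupuyhilado hand-off DH-9, rcat-lit-3 row L3-16): the one row of `plan/rescue/REPAIR-CATALOGUE.tsv`
v0.3 that was «UNTESTED on every column», its kernel cell reading «needs typing at a cell carrier: instantiate (7.3)
… and test ⟺ the typed Statement».

THE TWO TYPED OBJECTS (both already in the tree; this file adds no definition).
* `ExplicitSzpiro.TautologicalProbabilisticIneq X T lnRsup lnRsupArch` (`DHProbabilisticSzpiro`, p454750): the
  display (7.3) of [DupuyHilado2020] Thm. 7.5.1 p.23 l.15–28, «`−deĝ_{F₀}(P_q) ≤ Σ_{p∈V(ℚ)} E²_p(ln R°_v⃗)`», as a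
  HYPOTHESIS TEMPLATE over a DATUM of nonarchimedean log-radii `lnRsup p j v⃗` and archimedean ones `lnRsupArch j`
  (`E2 p ℓ⋆ f = (1/ℓ⋆)·Σ_j Σ_{v⃗} f j v⃗ · Π_k Pr(v_k)`, §7.1; `E2arch`).
* `ThetaVolumeInput.Cor312Of I` (`GenuineLogTheta`, abc-iut-S2): `−|log(q)| ≤ −|log(Θ)|` for a GENUINE Θ-volume
  input `I : ThetaVolumeInput F₀ K`, with `−|log(Θ)| = Σ_{p ∈ T(I)} ln ν̄_{𝕃_p}(hull(⋃ possible images of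
  O_𝕃(−div t_Θ))_p) + ((l+5)/4)·log π` — reading (U), the SHARP (Ind3)-datum, the archimedean summand of
  [IUTchIV] Thm. 1.10 Step (vii).

WHAT IS PROVED (kernel; standard axioms).
* `ThetaVolumeInput.E2_hullLogμ_eq_negLogThetaLoc` — at every index `p`, DH's `E²_p` of the datum
  «`ln R°_{(j,v⃗)}` := the normalised log-measure `log μ̄_{v⃗}` of the `(j,v⃗)`-component of the hull of the union of
  the possible images of the Θ-pilot region of `I`» IS the cell's summand `negLogThetaLoc I p` (both are the
  written-out procession average of the weighted tuple sums, [DupuyHilado2025] Def. 3.6.3; at a non-prime index both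
  vanish);
* `ThetaVolumeInput.E2arch_archRadiusLn_eq_archLogTheta` — DH's archimedean average of Claim 5.0.1's radii
  `(j+1)·ln π` IS the cell's archimedean summand `((l+5)/4)·log π` (`E2arch_archRadiusLn` + `l = 2ℓ⋆ + 1`);
* **`ThetaVolumeInput.tautologicalProbabilisticIneq_hull_iff_cor312Of`** — (7.3) instantiated at the pilot data
  `I.X`, the prime set `T(I) = I.supportPrimes`, the GENUINE hull log-radii above and the archimedean radii of Claim
  5.0.1 is EQUIVALENT — in fact definitionally the same real inequality — to `I.Cor312Of`.

KERNEL-CLOSE WORD FOR RC-607 (the tester's use of this file): «DH Thm 7.5.1's (7.3), read at the genuine hull radii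
of the cell's typed multiradial representation, RESTATES the cell's number-level typed Cor. 3.12 in reading (U)
(k4-type: `…_iff_cor312Of`); as a reading it is therefore DECIDED wherever `T.Cor312Of` is (e.g. TRUE with no
hypothesis at every genuine datum of the 283-triple at every level, `Conditional.Frey283.cor312Of_every` p490103;
for every abc triple with j ≠ 1728 at every prime l > 4abc, `WRow.cor312Of_triple_of_large` p501279), and as a
REPAIR it is n/a — the theorem is «Assuming [Moc15a, Corollary 3.12]» in print and supplies no comparison».

HONEST SCOPE. «ln R°_v⃗ = sup{ln R : U_v⃗ ⊂ D(0,R)}» (7.2) is print's log sup-radius of the hull component in the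
POLYDISC convention of DH-I §4.12 (hull = smallest polydisc); the cell's packets carry the normalised log-measure
`log μ̄_{v⃗}` of the hull component as the primitive ([DupuyHilado2025] (3.4) `log μ̄(a·O) = ln|a|_p`,
`logμ_peel_O`), and THAT is the datum fed to (7.3) here — a dictionary step (log-radius of a polydisc ↦ its
normalised log-measure), located, not adjudicated. Nothing here asserts (7.3), Cor. 3.12, or the existence of
Θ-data; no side is taken on [IUTchIII] Cor. 3.12 / [IUTchIV] Thm. 1.10 or on any author (Mochizuki / Scholze–Stix /
Joshi / Dupuy–Hilado); typed ≠ proved; restates-as-typed ≠ a statement about print; nothing asserts abc proved or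
refuted. [cite: DupuyHilado2020, Thm 7.5.1 (7.2)–(7.3) p.23 l.15–28; §7.1 p.22 l.31–53; Claim 5.0.1 p.18 l.29–30;
§7.11 p.27 l.22–30] [cite: DupuyHilado2025, Def. 3.6.3, §3.4, §4.12] [cite: Mochizuki2012, IUTchIII Cor. 3.12
p. 173–174; IUTchIV Thm. 1.10 Step (vii) p. 30] [claim: Mochizuki2012, status: disputed]
[claim: DupuyHilado2020, status: under-review]
-/

noncomputable section

namespace Literature.IUT.LogVolume

namespace ThetaVolumeInput

open ExplicitSzpiro

variable {F₀ : Type} [Field F₀] [NumberField F₀] {K : Type} [Field K] [NumberField K] [Algebra F₀ K]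
  (I : ThetaVolumeInput F₀ K)

/-- **DH's `E²_p` of the genuine hull log-radii = the cell's `p`-summand of `−|log(Θ)|`.** With the datum
`f p j v⃗ := log μ̄_{v⃗}` of the `(j, v⃗)`-component of `hull(⋃ possible images of O_𝕃(−div t_Θ))_p` of the genuine
input `I` (and `0` at a non-prime index, where nothing is summed), `E2 p ℓ⋆ (f p) = negLogThetaLoc I p` — both sides
are `(1/ℓ⋆)·Σ_{j=1}^{ℓ⋆} Σ_{v⃗ ∈ V(F₀)_p^{j+1}} log μ̄_{v⃗}(hull_{v⃗}) · Π_k Pr(v_k)` ([DupuyHilado2020] §7.1;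
[DupuyHilado2025] Def. 3.6.3). [cite: DupuyHilado2020, §7.1 p.22 l.44–53] [cite: DupuyHilado2025, Def. 3.6.3] -/
theorem E2_hullLogμ_eq_negLogThetaLoc (p : ℕ) :
    E2 p I.lstar (fun j e =>
        if hp : p.Prime then
          (I.packetAt p hp).logμ
            (((I.packetAt p hp).possibleImagesHull ((I.packetAt p hp).pilotRegion (I.tΘ p hp))) j e)
        else 0) = I.negLogThetaLoc p := by
  by_cases hp : p.Prime
  · rw [I.negLogThetaLoc_of_prime hp]
    simp only [dif_pos hp, E2, PrimePacket.negLogThetaAt, PrimePacket.lnνLp, PrimePacket.lnνTensorPower]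
  · rw [negLogThetaLoc, dif_neg hp]
    simp only [dif_neg hp, E2, zero_mul, Finset.sum_const_zero, mul_zero]

/-- **DH's archimedean average of Claim 5.0.1's radii = the cell's archimedean summand**:
`E2arch ℓ⋆ ((j+1)·ln π) = ((l+5)/4)·log π` (`ExplicitSzpiro.E2arch_archRadiusLn`, §7.11, with `l = 2ℓ⋆ + 1`).
[cite: DupuyHilado2020, §7.11 p.27 l.22–30] [cite: Mochizuki2012, IUTchIV Thm. 1.10 Step (vii) p. 30] -/
theorem E2arch_archRadiusLn_eq_archLogTheta :
    E2arch I.lstar archRadiusLn = archLogTheta I.l := by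
  have hl : 0 < I.lstar := by have := I.X.two_le_lstar; unfold lstar; omega
  rw [E2arch_archRadiusLn I.lstar hl, archLogTheta, I.X.l_cast]

/-- **RC-607 / DH-9 kernel cell: Dupuy–Hilado's (7.3) at the GENUINE hull log-radii ⟺ the number-level typed
Cor. 3.12 in reading (U).** Instantiating the hypothesis template `TautologicalProbabilisticIneq` (Thm. 7.5.1) at the
pilot data `I.X` of a genuine Θ-volume input, the prime set `T(I)`, the datum «log-measure of each hull component»
and the archimedean radii `(j+1)·ln π` of Claim 5.0.1 gives EXACTLY `I.Cor312Of` — the reading RESTATES the typed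
Corollary (reading (U), sharp (Ind3)-datum); it supplies no comparison (in print it is «Assuming [Moc15a, Corollary
3.12]»). [cite: DupuyHilado2020, Thm 7.5.1 (7.3) p.23 l.15–28] [cite: Mochizuki2012, IUTchIII Cor. 3.12 p. 173–174]
[claim: Mochizuki2012, status: disputed] [claim: DupuyHilado2020, status: under-review] -/
theorem tautologicalProbabilisticIneq_hull_iff_cor312Of :
    TautologicalProbabilisticIneq I.X I.supportPrimes
        (fun p j e =>
          if hp : p.Prime then
            (I.packetAt p hp).logμ
              (((I.packetAt p hp).possibleImagesHull ((I.packetAt p hp).pilotRegion (I.tΘ p hp))) j e)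
          else 0)
        archRadiusLn ↔ I.Cor312Of := by
  unfold TautologicalProbabilisticIneq Cor312Of negLogTheta negLogThetaNonarch negAbsLogQ
  rw [I.E2arch_archRadiusLn_eq_archLogTheta,
    Finset.sum_congr rfl fun p _ => I.E2_hullLogμ_eq_negLogThetaLoc p]

/-- One direction spelled out for consumers: wherever the cell's number-level Corollary holds as typed (e.g. the
§R/§S/§T.6 rows of the cell's records), DH's (7.3) holds at the genuine hull radii. [cite: DupuyHilado2020, Thm 7.5.1
(7.3) p.23 l.15–28] [claim: Mochizuki2012, status: disputed] -/
theorem tautologicalProbabilisticIneq_hull_of_cor312Of (h : I.Cor312Of) :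
    TautologicalProbabilisticIneq I.X I.supportPrimes
        (fun p j e =>
          if hp : p.Prime then
            (I.packetAt p hp).logμ
              (((I.packetAt p hp).possibleImagesHull ((I.packetAt p hp).pilotRegion (I.tΘ p hp))) j e)
          else 0)
        archRadiusLn :=
  I.tautologicalProbabilisticIneq_hull_iff_cor312Of.mpr h

/-- **DH-II's (7.4) from the cell's number-level typed Cor. 3.12 (reading (U)) and the explicit radius estimate.**
[DupuyHilado2020] derive everything downstream of Thm. 7.5.1 (§7.6–§8: Probabilistic / Baby / Explicit Szpiro, each stated
«Assume [Moc15a, Corollary 3.12] and Claim 5.0.1») from (7.4), and (7.4) from (7.3) together with the estimate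
`R°_v⃗ ≤ R_v⃗` of Lemma 6.3.1 / Claim 5.0.1 (`ineq74_of_tautological`, p.23 l.29–39). With the genuine hull log-radii of
this file, «Assume Cor. 3.12» is VERBATIM «assume `I.Cor312Of`»: the typed (U)-form plus the explicit estimate
`HullRadiusEstimate` at those radii (DH's Lemma 6.3.1 as a HYPOTHESIS on the genuine hull — typed, not proved here)
give `Ineq74`. No side taken; nothing asserted about print or about the truth of either hypothesis.
[cite: DupuyHilado2020, (7.4) p.23 l.29–39; Lemma 6.3.1 p.21 l.75–p.22 l.26; Claim 5.0.1 p.18 l.29–30]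
[claim: Mochizuki2012, status: disputed] [claim: DupuyHilado2020, status: under-review] -/
theorem ineq74_of_cor312Of_of_hullRadiusEstimate (R : SectionRamification F₀) (h : I.Cor312Of)
    (h63 : HullRadiusEstimate I.X R I.supportPrimes
        (fun p j e =>
          if hp : p.Prime then
            (I.packetAt p hp).logμ
              (((I.packetAt p hp).possibleImagesHull ((I.packetAt p hp).pilotRegion (I.tΘ p hp))) j e)
          else 0)
        archRadiusLn) : Ineq74 I.X R I.supportPrimes :=
  ineq74_of_tautological I.X R I.supportPrimes (I.tautologicalProbabilisticIneq_hull_of_cor312Of h) h63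

end ThetaVolumeInput

end Literature.IUT.LogVolume
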